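import Mathlib
import HarnessLib

/-!
# Line `Sketch` (v8) for crux `MagicFormulaT`, stub V `stub_vitaliCoeff`: Vitali's theorem on the
# real axis, coefficient form

Crux `Summit.CriticalPhenomena.CardyFormulaZ2.Theses.CardyMagicRigidity.MagicFormulaT`
(stmt-CriticalPhenomena-4836), line `Sketch`, registered skeleton v8, stub `stub_vitaliCoeff`:
if `F δ : ℂ → ℂ` is entire for all small `δ > 0`, the family is bounded on every closed ball
`‖t‖ ≤ ρ` eventually in `δ`, and `F δ t` converges as `δ → 0⁺` for every REAL `t`, then every
Taylor coefficient `iteratedDeriv k (F δ) 0` converges as `δ → 0⁺`.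

This is the coefficient form of the Vitali–Porter theorem; Montel's theorem is not in Mathlib, so
the proof is elementary:

* (order `0`, `vitaliCoeff_tendsto_zero`) for a family `G δ` that is entire eventually, bounded by
  `M` on `‖t‖ ≤ 2` eventually and convergent at every real `t ≠ 0`, the values `G δ 0` converge:
  the Schwarz lemma (`Complex.norm_dslope_le_div_of_mapsTo_ball`) bounds the divided difference
  `dslope (G δ) 0` by `M` on `‖t‖ ≤ 1`, so `‖G δ t − G δ 0‖ ≤ (|M|+1)‖t‖` uniformly in `δ`; with a
  small real `t₀ > 0` and the convergence of `G δ t₀` the filter image of `δ ↦ G δ 0` is Cauchy in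
  the complete space `ℂ` (`cauchy_map_iff_exists_tendsto`, `Metric.cauchy_iff`);
* (all orders) the package "entire eventually ∧ bounded on balls eventually ∧ convergent at real
  `t ≠ 0`" passes from `G δ` to the divided difference `dslope (G δ) 0`
  (`Complex.differentiableOn_dslope`, the Schwarz bound again, and order `0` for the value at `0`
  entering `dslope (G δ) 0 t = t⁻¹ (G δ t − G δ 0)`), hence to all iterates
  `(swap dslope 0)^[k] (F δ)`; their values at `0` converge by order `0`, and
  `iteratedDeriv k g 0 = k! · (swap dslope 0)^[k] g 0` for an entire `g`
  (`HasFPowerSeriesAt.has_fpower_series_iterate_dslope_fslope`,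
  `FormalMultilinearSeries.coeff_iterate_fslope`, `HasFPowerSeriesOnBall.factorial_smul`).

Pure Mathlib; no named fact is used; no definition is introduced.
-/

noncomputable section

namespace Summit.CriticalPhenomena.CardyFormulaZ2.Cruxes.MagicFormulaT.LineSketch

open MeasureTheory Filter Set Metric Function
open scoped Real Topology BigOperators ENNReal

/-! ## The Schwarz bound for the divided difference at the origin -/

/-- If `g` is entire and `‖g t‖ ≤ M` on the closed ball `‖t‖ ≤ 2ρ` (`ρ > 0`), then the divided
difference `dslope g 0` (`= (g t − g 0)/t` off `0`, `= g' 0` at `0`) is bounded by `M/ρ` on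
`‖t‖ ≤ ρ`.  Schwarz lemma `Complex.norm_dslope_le_div_of_mapsTo_ball` for the map of `ball 0 (2ρ)`
into `closedBall (g 0) (2M)`. -/
theorem vitaliCoeff_norm_dslope_le {g : ℂ → ℂ} (hg : Differentiable ℂ g) {ρ M : ℝ} (hρ : 0 < ρ)
    (hM : ∀ t : ℂ, ‖t‖ ≤ 2 * ρ → ‖g t‖ ≤ M) (t : ℂ) (ht : ‖t‖ ≤ ρ) :
    ‖dslope g 0 t‖ ≤ M / ρ := by
  have hmaps : MapsTo g (ball (0 : ℂ) (2 * ρ)) (closedBall (g 0) (2 * M)) := by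
    intro z hz
    rw [mem_closedBall, dist_eq_norm]
    have hz' : ‖z‖ ≤ 2 * ρ := (mem_ball_zero_iff.1 hz).le
    calc ‖g z - g 0‖ ≤ ‖g z‖ + ‖g 0‖ := norm_sub_le _ _
      _ ≤ M + M := add_le_add (hM z hz') (hM 0 (by rw [norm_zero]; positivity))
      _ = 2 * M := by ring
  have ht' : t ∈ ball (0 : ℂ) (2 * ρ) := by
    rw [mem_ball_zero_iff]
    linarith
  calc ‖dslope g 0 t‖ ≤ 2 * M / (2 * ρ) :=
        Complex.norm_dslope_le_div_of_mapsTo_ball hg.differentiableOn hmaps ht'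
    _ = M / ρ := mul_div_mul_left M ρ two_ne_zero

/-! ## Order zero: convergence at the origin from convergence at small positive reals -/

/-- **Order `0`.**  Let `G δ : ℂ → ℂ` be entire for all small `δ > 0`, bounded on every closed
ball eventually in `δ`, and such that `G δ t` converges as `δ → 0⁺` for every real `t ≠ 0`.  Then
`G δ 0` converges as `δ → 0⁺`.  Proof: by `vitaliCoeff_norm_dslope_le`,
`‖G δ t − G δ 0‖ ≤ (|M|+1)‖t‖` on `‖t‖ ≤ 1` eventually in `δ` (`M` a bound on `‖t‖ ≤ 2`); for
`ε > 0` pick a real `0 < t₀ ≤ 1` with `(|M|+1) t₀ ≤ ε/3`; eventually `G δ t₀` is `ε/6`-close to its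
limit, so `δ ↦ G δ 0` has `ε`-small oscillation on a set of the filter: the image filter is Cauchy
in the complete space `ℂ`. -/
theorem vitaliCoeff_tendsto_zero {G : ℝ → ℂ → ℂ}
    (hd : ∀ᶠ δ in 𝓝[>] (0 : ℝ), Differentiable ℂ (G δ))
    (hb : ∀ ρ : ℝ, 0 < ρ → ∃ M : ℝ, ∀ᶠ δ in 𝓝[>] (0 : ℝ), ∀ t : ℂ, ‖t‖ ≤ ρ → ‖G δ t‖ ≤ M)
    (hc : ∀ t : ℝ, t ≠ 0 → ∃ L : ℂ, Tendsto (fun δ ↦ G δ (t : ℂ)) (𝓝[>] (0 : ℝ)) (𝓝 L)) :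
    ∃ L : ℂ, Tendsto (fun δ ↦ G δ 0) (𝓝[>] (0 : ℝ)) (𝓝 L) := by
  obtain ⟨M, hM⟩ := hb (2 * 1) (by norm_num)
  set M' : ℝ := |M| + 1 with hM'def
  have hM'pos : 0 < M' := by positivity
  -- uniform Lipschitz-type estimate at the origin
  have hlip : ∀ᶠ δ in 𝓝[>] (0 : ℝ), ∀ t : ℂ, ‖t‖ ≤ 1 → ‖G δ t - G δ 0‖ ≤ M' * ‖t‖ := by
    filter_upwards [hd, hM] with δ hdδ hMδ t ht
    have h1 : ‖dslope (G δ) 0 t‖ ≤ M / 1 := vitaliCoeff_norm_dslope_le hdδ one_pos hMδ t ht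
    have h2 : ‖dslope (G δ) 0 t‖ ≤ M' := by
      rw [div_one] at h1
      exact h1.trans ((le_abs_self M).trans (lt_add_one _).le)
    have h3 : G δ t - G δ 0 = t • dslope (G δ) 0 t := by
      rw [← sub_smul_dslope (G δ) 0 t, sub_zero]
    rw [h3, norm_smul, mul_comm]
    exact mul_le_mul_of_nonneg_right h2 (norm_nonneg _)
  rw [← cauchy_map_iff_exists_tendsto, Metric.cauchy_iff]
  refine ⟨inferInstance, fun ε hε ↦ ?_⟩
  -- a small positive real coupling
  set t₀ : ℝ := min 1 (ε / (3 * M')) with ht₀def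
  have ht₀pos : 0 < t₀ := lt_min one_pos (by positivity)
  have ht₀le : t₀ ≤ 1 := min_le_left _ _
  have hMt₀ : M' * t₀ ≤ ε / 3 := by
    calc M' * t₀ ≤ M' * (ε / (3 * M')) := mul_le_mul_of_nonneg_left (min_le_right _ _) hM'pos.le
      _ = ε / 3 := by field_simp
  have hnorm' : ‖(t₀ : ℂ)‖ = t₀ := by
    rw [Complex.norm_real, Real.norm_eq_abs, abs_of_pos ht₀pos]
  have hnorm : ‖(t₀ : ℂ)‖ ≤ 1 := hnorm'.le.trans ht₀le
  obtain ⟨L, hL⟩ := hc t₀ ht₀pos.ne'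
  have hL' : ∀ᶠ δ in 𝓝[>] (0 : ℝ), dist (G δ t₀) L < ε / 6 :=
    Metric.tendsto_nhds.1 hL _ (by positivity)
  obtain ⟨S, hS, hgood⟩ := (hlip.and hL').exists_mem
  refine ⟨(fun δ ↦ G δ 0) '' S, image_mem_map hS, ?_⟩
  rintro _ ⟨δ, hδ, rfl⟩ _ ⟨δ', hδ', rfl⟩
  obtain ⟨h1, h2⟩ := hgood δ hδ
  obtain ⟨h1', h2'⟩ := hgood δ' hδ'
  have e1 : dist (G δ 0) (G δ t₀) ≤ ε / 3 := by
    rw [dist_comm, dist_eq_norm]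
    calc ‖G δ t₀ - G δ 0‖ ≤ M' * ‖(t₀ : ℂ)‖ := h1 _ hnorm
      _ = M' * t₀ := by rw [hnorm']
      _ ≤ ε / 3 := hMt₀
  have e3 : dist (G δ' t₀) (G δ' 0) ≤ ε / 3 := by
    rw [dist_eq_norm]
    calc ‖G δ' t₀ - G δ' 0‖ ≤ M' * ‖(t₀ : ℂ)‖ := h1' _ hnorm
      _ = M' * t₀ := by rw [hnorm']
      _ ≤ ε / 3 := hMt₀
  have e2 : dist (G δ t₀) (G δ' t₀) < ε / 3 := by
    calc dist (G δ t₀) (G δ' t₀) ≤ dist (G δ t₀) L + dist (G δ' t₀) L :=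
          dist_triangle_right _ _ _
      _ < ε / 6 + ε / 6 := add_lt_add h2 h2'
      _ = ε / 3 := by ring
  dsimp only
  calc dist (G δ 0) (G δ' 0)
      ≤ dist (G δ 0) (G δ t₀) + dist (G δ t₀) (G δ' t₀) + dist (G δ' t₀) (G δ' 0) :=
        dist_triangle4 _ _ _ _
    _ < ε / 3 + ε / 3 + ε / 3 := by linarith
    _ = ε := by ring

/-! ## The package passes to divided differences -/

/-- **Induction step.**  If the family `G δ` is entire eventually, bounded on every closed ball
eventually, and convergent at every real `t ≠ 0` (as `δ → 0⁺`), then so is the family of divided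
differences `dslope (G δ) 0`: entire by `Complex.differentiableOn_dslope`; bounded on `‖t‖ ≤ ρ` by
`M/ρ` with `M` a bound of `G δ` on `‖t‖ ≤ 2ρ` (`vitaliCoeff_norm_dslope_le`); convergent at real
`t ≠ 0` because `dslope (G δ) 0 t = t⁻¹ • (G δ t − G δ 0)` and `G δ 0` converges by
`vitaliCoeff_tendsto_zero`. -/
theorem vitaliCoeff_dslope_package {G : ℝ → ℂ → ℂ}
    (hd : ∀ᶠ δ in 𝓝[>] (0 : ℝ), Differentiable ℂ (G δ))
    (hb : ∀ ρ : ℝ, 0 < ρ → ∃ M : ℝ, ∀ᶠ δ in 𝓝[>] (0 : ℝ), ∀ t : ℂ, ‖t‖ ≤ ρ → ‖G δ t‖ ≤ M)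
    (hc : ∀ t : ℝ, t ≠ 0 → ∃ L : ℂ, Tendsto (fun δ ↦ G δ (t : ℂ)) (𝓝[>] (0 : ℝ)) (𝓝 L)) :
    (∀ᶠ δ in 𝓝[>] (0 : ℝ), Differentiable ℂ (dslope (G δ) 0)) ∧
    (∀ ρ : ℝ, 0 < ρ → ∃ M : ℝ, ∀ᶠ δ in 𝓝[>] (0 : ℝ), ∀ t : ℂ, ‖t‖ ≤ ρ →
      ‖dslope (G δ) 0 t‖ ≤ M) ∧
    (∀ t : ℝ, t ≠ 0 → ∃ L : ℂ,
      Tendsto (fun δ ↦ dslope (G δ) 0 (t : ℂ)) (𝓝[>] (0 : ℝ)) (𝓝 L)) := by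
  refine ⟨?_, ?_, ?_⟩
  · filter_upwards [hd] with δ hδ
    rw [← differentiableOn_univ] at hδ ⊢
    exact (Complex.differentiableOn_dslope univ_mem).2 hδ
  · intro ρ hρ
    obtain ⟨M, hM⟩ := hb (2 * ρ) (by positivity)
    refine ⟨M / ρ, ?_⟩
    filter_upwards [hd, hM] with δ hdδ hMδ t ht
    exact vitaliCoeff_norm_dslope_le hdδ hρ hMδ t ht
  · intro t ht
    obtain ⟨L₀, hL₀⟩ := vitaliCoeff_tendsto_zero hd hb hc
    obtain ⟨L, hL⟩ := hc t ht
    have ht' : (t : ℂ) ≠ 0 := by exact_mod_cast ht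
    refine ⟨((t : ℂ) - 0)⁻¹ • (L - L₀), ?_⟩
    have heq : (fun δ ↦ dslope (G δ) 0 (t : ℂ)) =
        fun δ ↦ ((t : ℂ) - 0)⁻¹ • (G δ t - G δ 0) := by
      funext δ
      rw [dslope_of_ne _ ht', slope_def_module]
    rw [heq]
    exact (hL.sub hL₀).const_smul _

/-- **All iterates.**  Under the same hypotheses on `G δ`, every iterated divided difference
`(swap dslope 0)^[k] (G δ)` is entire eventually, bounded on every closed ball eventually, and
convergent at every real `t ≠ 0`; induction on `k` with `vitaliCoeff_dslope_package`. -/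
theorem vitaliCoeff_iterate_package {G : ℝ → ℂ → ℂ}
    (hd : ∀ᶠ δ in 𝓝[>] (0 : ℝ), Differentiable ℂ (G δ))
    (hb : ∀ ρ : ℝ, 0 < ρ → ∃ M : ℝ, ∀ᶠ δ in 𝓝[>] (0 : ℝ), ∀ t : ℂ, ‖t‖ ≤ ρ → ‖G δ t‖ ≤ M)
    (hc : ∀ t : ℝ, t ≠ 0 → ∃ L : ℂ, Tendsto (fun δ ↦ G δ (t : ℂ)) (𝓝[>] (0 : ℝ)) (𝓝 L))
    (k : ℕ) :
    (∀ᶠ δ in 𝓝[>] (0 : ℝ), Differentiable ℂ ((swap dslope (0 : ℂ))^[k] (G δ))) ∧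
    (∀ ρ : ℝ, 0 < ρ → ∃ M : ℝ, ∀ᶠ δ in 𝓝[>] (0 : ℝ), ∀ t : ℂ, ‖t‖ ≤ ρ →
      ‖(swap dslope (0 : ℂ))^[k] (G δ) t‖ ≤ M) ∧
    (∀ t : ℝ, t ≠ 0 → ∃ L : ℂ,
      Tendsto (fun δ ↦ (swap dslope (0 : ℂ))^[k] (G δ) (t : ℂ)) (𝓝[>] (0 : ℝ)) (𝓝 L)) := by
  induction k with
  | zero => simpa using ⟨hd, hb, hc⟩
  | succ k ih =>
    obtain ⟨hd', hb', hc'⟩ := ih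
    simp only [Function.iterate_succ_apply']
    exact vitaliCoeff_dslope_package hd' hb' hc'

/-! ## The value of the iterated divided difference at the origin -/

/-- For an entire `g`, the `k`-th iterated divided difference at the origin is the `k`-th Taylor
coefficient: `iteratedDeriv k g 0 = k! · (swap dslope 0)^[k] g 0`.  Power series: `g` has a power
series `p` at `0` (`Differentiable.analyticAt`), `(swap dslope 0)^[k] g` has `fslope^[k] p`
(`HasFPowerSeriesAt.has_fpower_series_iterate_dslope_fslope`), whose constant term is `p.coeff k`
(`FormalMultilinearSeries.coeff_iterate_fslope`), and `k! · p.coeff k = iteratedDeriv k g 0`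
(`HasFPowerSeriesOnBall.factorial_smul`). -/
theorem vitaliCoeff_iteratedDeriv_eq {g : ℂ → ℂ} (hg : Differentiable ℂ g) (k : ℕ) :
    iteratedDeriv k g 0 = (k.factorial : ℂ) * (swap dslope (0 : ℂ))^[k] g 0 := by
  obtain ⟨p, r, hp⟩ := hg.analyticAt 0
  have h1 : (swap dslope (0 : ℂ))^[k] g 0 = p.coeff k := by
    rw [← (hp.hasFPowerSeriesAt.has_fpower_series_iterate_dslope_fslope k).coeff_zero 1]
    change (FormalMultilinearSeries.fslope^[k] p).coeff 0 = p.coeff k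
    rw [FormalMultilinearSeries.coeff_iterate_fslope, zero_add]
  have h2 : (k.factorial : ℂ) * p.coeff k = iteratedDeriv k g 0 := by
    have h := hp.factorial_smul 1 k
    rw [iteratedDeriv_eq_iteratedFDeriv, ← h, FormalMultilinearSeries.apply_eq_pow_smul_coeff,
      one_pow, one_smul, nsmul_eq_mul]
  rw [h1, h2]

/-! ## The stub -/

/-- **Stub V (`stub_vitaliCoeff`) · Vitali on the real axis, coefficient form.**  If `F_δ` is
entire for all small `δ`, uniformly bounded on each closed ball eventually in `δ`, and `F_δ(t)`
converges as `δ → 0⁺` for every REAL `t`, then every Taylor coefficient `F_δ^{(k)}(0)` converges as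
`δ → 0⁺`.  Proof: the package of `vitaliCoeff_iterate_package` for the `k`-th iterated divided
difference, order `0` (`vitaliCoeff_tendsto_zero`) for its value at `0`, and
`iteratedDeriv k (F δ) 0 = k! · (swap dslope 0)^[k] (F δ) 0` (`vitaliCoeff_iteratedDeriv_eq`)
eventually in `δ`. -/
theorem stub_vitaliCoeff : ∀ (F : ℝ → ℂ → ℂ),
    (∀ᶠ δ in 𝓝[>] (0 : ℝ), Differentiable ℂ (F δ)) →
    (∀ ρ : ℝ, 0 < ρ → ∃ M : ℝ, ∀ᶠ δ in 𝓝[>] (0 : ℝ), ∀ t : ℂ, ‖t‖ ≤ ρ → ‖F δ t‖ ≤ M) →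
    (∀ t : ℝ, ∃ L : ℂ, Tendsto (fun δ ↦ F δ (t : ℂ)) (𝓝[>] (0 : ℝ)) (𝓝 L)) →
    ∀ k : ℕ, ∃ a : ℂ, Tendsto (fun δ ↦ iteratedDeriv k (F δ) 0) (𝓝[>] (0 : ℝ)) (𝓝 a) := by
  intro F hd hb hc k
  obtain ⟨hd', hb', hc'⟩ := vitaliCoeff_iterate_package hd hb (fun t _ ↦ hc t) k
  obtain ⟨a, ha⟩ := vitaliCoeff_tendsto_zero hd' hb' hc'
  refine ⟨(k.factorial : ℂ) * a, (ha.const_mul (k.factorial : ℂ)).congr' ?_⟩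
  filter_upwards [hd] with δ hδ
  exact (vitaliCoeff_iteratedDeriv_eq hδ k).symm

end Summit.CriticalPhenomena.CardyFormulaZ2.Cruxes.MagicFormulaT.LineSketch
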